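import Summits.CriticalPhenomena.CardyFormulaZ2.Theorems.CardyQContinuationIsingJetsConformalStubDesignMeshQuadComb

/-!
# Combinatorics of Chelkak–Smirnov square-lattice quadrilaterals, II: positions along the cycle
(route CardyQContinuation, serves stmt-CriticalPhenomena-5560: helper for the registered stub
`stub_design_meshQuad` of the n = 0 bridge of the crux `IsingJetsConformal`)

Positions along the boundary cycle `D i = succ^[i] d₀` of a presented rectangle `(E, d₀, n)`:
white positions (`whitePos`, the darts of the arcs `1, 3`), white-inner positions
(`winnerPos`, those whose walked arrows lie strictly inside a white arc), their successor
bookkeeping, and the dictionary with `arcDarts`, `innerArrows`, `blackArrows` of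
`FKIsingQuadrilateralCrossing` (`mem_whiteDarts_iff`, `mem_whiteArrows_iff`, `mem_blackArrows_iff`);
every walked arrow (edge of `E` with an exterior right square) has a unique position
(`exists_pos_of_walked`, `pos_unique`), hence is white-inner or black and not both. [folklore]
-/

namespace Summit.CriticalPhenomena.CardyFormulaZ2.Theorems.CardyQContinuation

namespace CSQuad

open Literature.Probability.LatticeModels Literature.Probability.LatticeModels.DiscreteRect
open Summit.CriticalPhenomena.SAWScalingLimit.Theorems.IsingBoundaryRatio

variable {E : Finset (Sym2 (Site 2))}

/-! ### Positions along the boundary cycle of a presented rectangle -/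

section Positions

variable (n : Fin 4 → ℕ)

/-- The positions of the WHITE darts (arcs `1` and `3`) within one period. [folklore] -/
def whitePos : Finset ℕ :=
  Finset.Ico (n 0) (n 0 + n 1) ∪ Finset.Ico (n 0 + n 1 + n 2) (n 0 + n 1 + n 2 + n 3)

/-- The positions whose walked arrows are WHITE INNER arrows (strictly inside a white arc).
[folklore] -/
def winnerPos : Finset ℕ :=
  Finset.Ico (n 0) (n 0 + n 1 - 1) ∪ Finset.Ico (n 0 + n 1 + n 2) (n 0 + n 1 + n 2 + n 3 - 1)

variable {n}

/-- Membership in `whitePos`, unfolded. [folklore] -/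
theorem mem_whitePos {i : ℕ} : i ∈ whitePos n ↔
    (n 0 ≤ i ∧ i < n 0 + n 1) ∨ (n 0 + n 1 + n 2 ≤ i ∧ i < n 0 + n 1 + n 2 + n 3) := by
  simp [whitePos]

/-- Membership in `winnerPos`, unfolded. [folklore] -/
theorem mem_winnerPos {i : ℕ} : i ∈ winnerPos n ↔
    (n 0 ≤ i ∧ i + 1 < n 0 + n 1) ∨ (n 0 + n 1 + n 2 ≤ i ∧ i + 1 < n 0 + n 1 + n 2 + n 3) := by
  simp only [winnerPos, Finset.mem_union, Finset.mem_Ico]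
  omega

/-- A white-inner position is white. [folklore] -/
theorem whitePos_of_winnerPos {i : ℕ} (h : i ∈ winnerPos n) : i ∈ whitePos n := by
  rw [mem_winnerPos] at h; rw [mem_whitePos]; omega

/-- After a white-inner position comes a white position. [folklore] -/
theorem succ_whitePos_of_winnerPos {i : ℕ} (h : i ∈ winnerPos n) : i + 1 ∈ whitePos n := by
  rw [mem_winnerPos] at h; rw [mem_whitePos]; omega

/-- A white position is white-inner iff the next position is white. [folklore] -/
theorem winnerPos_iff_succ {i : ℕ} (hpos : ∀ j, 0 < n j) (h : i ∈ whitePos n) :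
    i ∈ winnerPos n ↔ i + 1 ∈ whitePos n := by
  have := hpos 2
  rw [mem_whitePos] at h ⊢; rw [mem_winnerPos]; omega

/-- A white position that is not white-inner is the last position of a white arc. [folklore] -/
theorem eq_last_of_whitePos {i : ℕ} (h : i ∈ whitePos n) (h' : i ∉ winnerPos n) :
    i = n 0 + n 1 - 1 ∨ i = n 0 + n 1 + n 2 + n 3 - 1 := by
  rw [mem_whitePos] at h; rw [mem_winnerPos] at h'; omega

/-- A white position following a non-white one is the first position of a white arc. [folklore] -/
theorem eq_first_of_succ_whitePos {i : ℕ} (h : i ∉ whitePos n) (h' : i + 1 ∈ whitePos n) :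
    i + 1 = n 0 ∨ i + 1 = n 0 + n 1 + n 2 := by
  rw [mem_whitePos] at h h'; omega

/-- White positions lie within the period. [folklore] -/
theorem lt_of_whitePos {i : ℕ} (h : i ∈ whitePos n) : i < n 0 + n 1 + n 2 + n 3 := by
  rw [mem_whitePos] at h; omega

/-- White-inner positions lie within the period. [folklore] -/
theorem lt_of_winnerPos {i : ℕ} (h : i ∈ winnerPos n) : i < n 0 + n 1 + n 2 + n 3 := by
  rw [mem_winnerPos] at h; omega

end Positions

/-! ### The dictionary with `arcDarts`, `innerArrows`, `blackArrows` -/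

section Dictionary

variable {d₀ : Site 2 × Fin 4} {n : Fin 4 → ℕ}

/-- `lo` unfolded. [folklore] -/
theorem lo_zero (n : Fin 4 → ℕ) : lo n 0 = 0 := rfl
/-- `lo` unfolded. [folklore] -/
theorem lo_one (n : Fin 4 → ℕ) : lo n 1 = n 0 := rfl
/-- `lo` unfolded. [folklore] -/
theorem lo_two (n : Fin 4 → ℕ) : lo n 2 = n 0 + n 1 := rfl
/-- `lo` unfolded. [folklore] -/
theorem lo_three (n : Fin 4 → ℕ) : lo n 3 = n 0 + n 1 + n 2 := rfl

/-- **White darts are the darts at white positions.** [folklore] -/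
theorem mem_whiteDarts_iff {d : Site 2 × Fin 4} :
    d ∈ arcDarts E d₀ n 1 ∪ arcDarts E d₀ n 3 ↔ ∃ i, i ∈ whitePos n ∧ (succ E)^[i] d₀ = d := by
  simp only [Finset.mem_union, arcDarts, Finset.mem_image, Finset.mem_Ico, lo_one, lo_three, mem_whitePos]
  constructor
  · rintro (⟨i, hi, rfl⟩ | ⟨i, hi, rfl⟩)
    · exact ⟨i, Or.inl hi, rfl⟩
    · exact ⟨i, Or.inr hi, rfl⟩
  · rintro ⟨i, hi | hi, rfl⟩
    · exact Or.inl ⟨i, hi, rfl⟩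
    · exact Or.inr ⟨i, hi, rfl⟩

/-- **White inner arrows are the arrows walked from white-inner positions.** [folklore] -/
theorem mem_whiteArrows_iff {a : Site 2 × Fin 4} :
    a ∈ innerArrows E d₀ n 1 ∪ innerArrows E d₀ n 3 ↔
      ∃ i, i ∈ winnerPos n ∧ a ∈ slots E ((succ E)^[i] d₀) := by
  simp only [Finset.mem_union, innerArrows, Finset.mem_biUnion, Finset.mem_Ico, lo_one, lo_three,
    mem_winnerPos]
  constructor
  · rintro (⟨i, hi, ha⟩ | ⟨i, hi, ha⟩)
    · exact ⟨i, Or.inl (by omega), ha⟩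
    · exact ⟨i, Or.inr (by omega), ha⟩
  · rintro ⟨i, hi | hi, ha⟩
    · exact Or.inl ⟨i, by omega, ha⟩
    · exact Or.inr ⟨i, by omega, ha⟩

/-- **Black arrows are the arrows walked from the positions that are not white-inner** (for a
periodic orbit with positive arc lengths). [folklore] -/
theorem mem_blackArrows_iff (hper : (succ E)^[n 0 + n 1 + n 2 + n 3] d₀ = d₀) (hpos : ∀ j, 0 < n j)
    {a : Site 2 × Fin 4} :
    a ∈ blackArrows E d₀ n 0 ∪ blackArrows E d₀ n 2 ↔
      ∃ i, i < n 0 + n 1 + n 2 + n 3 ∧ i ∉ winnerPos n ∧ a ∈ slots E ((succ E)^[i] d₀) := by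
  have h0 := hpos 0; have h1 := hpos 1; have h2 := hpos 2; have h3 := hpos 3
  set N := n 0 + n 1 + n 2 + n 3 with hN
  have hshift : ∀ i, (succ E)^[i + N] d₀ = (succ E)^[i] d₀ := fun i ↦ by
    rw [Function.iterate_add_apply, hper]
  simp only [Finset.mem_union, blackArrows, Finset.mem_biUnion, Finset.mem_Ico, lo_zero, lo_two,
    mem_winnerPos, ← hN]
  constructor
  · rintro (⟨i, ⟨hi1, hi2⟩, ha⟩ | ⟨i, ⟨hi1, hi2⟩, ha⟩)
    · by_cases hi : i < N
      · exact ⟨i, hi, by omega, ha⟩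
      · refine ⟨i - N, by omega, by omega, ?_⟩
        rwa [← hshift, Nat.sub_add_cancel (by omega)]
    · by_cases hi : i < N
      · exact ⟨i, hi, by omega, ha⟩
      · refine ⟨i - N, by omega, by omega, ?_⟩
        rwa [← hshift, Nat.sub_add_cancel (by omega)]
  · rintro ⟨i, hi, hw, ha⟩
    by_cases hc : i < n 0
    · exact Or.inl ⟨i + N, by omega, by rwa [hshift]⟩
    · by_cases hc' : i = N - 1
      · subst hc'
        exact Or.inl ⟨N - 1, by omega, ha⟩
      · exact Or.inr ⟨i + N, by omega, by rwa [hshift]⟩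

/-- **Every walked arrow has a position**: an arrow of `E` with no face on its right is walked from
exactly one position of the boundary cycle of a presented rectangle. [folklore] -/
theorem exists_pos_of_walked (hR : IsRect E d₀ n) {a : Site 2 × Fin 4} (ha : aedge a ∈ E)
    (hF : ¬ InF E (rsq a)) : ∃ i, i < n 0 + n 1 + n 2 + n 3 ∧ a ∈ slots E ((succ E)^[i] d₀) := by
  have : a ∈ (arrows E).filter (fun a ↦ ¬ InF E (rsq a)) := by
    rw [Finset.mem_filter, mem_arrows]; exact ⟨ha, hF⟩
  rw [← hR.biUnion_slots_eq, Finset.mem_biUnion] at this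
  obtain ⟨i, hi, hai⟩ := this
  exact ⟨i, Finset.mem_range.1 hi, hai⟩

/-- The position of a walked arrow is unique. [folklore] -/
theorem pos_unique (hR : IsRect E d₀ n) {a : Site 2 × Fin 4} {i j : ℕ} (hi : i < n 0 + n 1 + n 2 + n 3)
    (hj : j < n 0 + n 1 + n 2 + n 3) (hai : a ∈ slots E ((succ E)^[i] d₀))
    (haj : a ∈ slots E ((succ E)^[j] d₀)) : i = j := by
  by_contra hne
  have := hR.pairwiseDisjoint_slots (Finset.mem_coe.2 (Finset.mem_range.2 hi))
    (Finset.mem_coe.2 (Finset.mem_range.2 hj)) hne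
  exact Finset.disjoint_left.1 this hai haj

/-- **A walked arrow is white-inner or black, not both.** [folklore] -/
theorem mem_whiteArrows_or_mem_blackArrows (hR : IsRect E d₀ n) {a : Site 2 × Fin 4} (ha : aedge a ∈ E)
    (hF : ¬ InF E (rsq a)) :
    (a ∈ innerArrows E d₀ n 1 ∪ innerArrows E d₀ n 3) ∨ (a ∈ blackArrows E d₀ n 0 ∪ blackArrows E d₀ n 2) := by
  obtain ⟨i, hi, hai⟩ := exists_pos_of_walked hR ha hF
  by_cases hw : i ∈ winnerPos n
  · exact Or.inl (mem_whiteArrows_iff.2 ⟨i, hw, hai⟩)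
  · exact Or.inr ((mem_blackArrows_iff hR.periodic hR.pos).2 ⟨i, hi, hw, hai⟩)

/-- A walked arrow is not both white-inner and black. [folklore] -/
theorem not_mem_blackArrows_of_mem_whiteArrows (hR : IsRect E d₀ n) {a : Site 2 × Fin 4}
    (hw : a ∈ innerArrows E d₀ n 1 ∪ innerArrows E d₀ n 3) :
    a ∉ blackArrows E d₀ n 0 ∪ blackArrows E d₀ n 2 := by
  intro hb
  obtain ⟨i, hi, hai⟩ := mem_whiteArrows_iff.1 hw
  obtain ⟨j, hj, hj', haj⟩ := (mem_blackArrows_iff hR.periodic hR.pos).1 hb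
  have hiN : i < n 0 + n 1 + n 2 + n 3 := lt_of_winnerPos hi
  have := pos_unique hR hiN hj hai haj
  subst this
  exact hj' hi

/-- White inner arrows are edges of `E` with an exterior right square. [folklore] -/
theorem aedge_mem_of_mem_whiteArrows (hR : IsRect E d₀ n) {a : Site 2 × Fin 4}
    (hw : a ∈ innerArrows E d₀ n 1 ∪ innerArrows E d₀ n 3) : aedge a ∈ E ∧ ¬ InF E (rsq a) := by
  obtain ⟨i, -, hai⟩ := mem_whiteArrows_iff.1 hw
  refine ⟨aedge_mem_of_mem_slots hai, ?_⟩
  rw [rsq_of_mem_slots hai]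
  exact not_inF_quad (hR.isExtDart_iterate i).2

/-- Black arrows are edges of `E` with an exterior right square. [folklore] -/
theorem aedge_mem_of_mem_blackArrows (hR : IsRect E d₀ n) {a : Site 2 × Fin 4}
    (hb : a ∈ blackArrows E d₀ n 0 ∪ blackArrows E d₀ n 2) : aedge a ∈ E ∧ ¬ InF E (rsq a) := by
  obtain ⟨i, -, -, hai⟩ := (mem_blackArrows_iff hR.periodic hR.pos).1 hb
  refine ⟨aedge_mem_of_mem_slots hai, ?_⟩
  rw [rsq_of_mem_slots hai]
  exact not_inF_quad (hR.isExtDart_iterate i).2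

/-- White darts are external darts. [folklore] -/
theorem isExtDart_of_mem_whiteDarts (hR : IsRect E d₀ n) {d : Site 2 × Fin 4}
    (hw : d ∈ arcDarts E d₀ n 1 ∪ arcDarts E d₀ n 3) : IsExtDart E d := by
  obtain ⟨i, -, rfl⟩ := mem_whiteDarts_iff.1 hw
  exact hR.isExtDart_iterate i

/-- **The position of an external dart** within the period. [folklore] -/
theorem exists_pos_of_isExtDart (hR : IsRect E d₀ n) {d : Site 2 × Fin 4} (hd : IsExtDart E d) :
    ∃ i, i < n 0 + n 1 + n 2 + n 3 ∧ (succ E)^[i] d₀ = d :=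
  let ⟨i, hi, h⟩ := hR.cover d hd
  ⟨i, hi, h⟩

/-- The next position along the cycle. [folklore] -/
theorem iterate_succ_eq (E : Finset (Sym2 (Site 2))) (d₀ : Site 2 × Fin 4) (i : ℕ) :
    (succ E)^[i + 1] d₀ = succ E ((succ E)^[i] d₀) :=
  Function.iterate_succ_apply' _ _ _

/-- The dart at the position after the last one is the first dart. [folklore] -/
theorem iterate_mod (hR : IsRect E d₀ n) (i : ℕ) :
    (succ E)^[i % (n 0 + n 1 + n 2 + n 3)] d₀ = (succ E)^[i] d₀ :=
  WindowRect.iterate_mod_eq hR.periodic i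

end Dictionary

end CSQuad

end Summit.CriticalPhenomena.CardyFormulaZ2.Theorems.CardyQContinuation
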